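import Mathlib
import Literature.Barriers.PneNP.CorrelationPolytopeXCLowerBoundGraph
import Literature.Barriers.PneNP.ExtendedFormulationMinkowskiFaces
import Literature.Barriers.PneNP.ExtendedFormulationLinearImage
import Summits.ValiantsHypothesis.ValiantsHypothesis.Theorems.FifoMatchingXcMinkowskiMultiplesHard
import Summits.ValiantsHypothesis.ValiantsHypothesis.Theorems.FifoMatchingXcDivisionZmixFace
import Summits.ValiantsHypothesis.ValiantsHypothesis.Theorems.FifoMatchingNNDivisionHardLocatedFaceExposure
import Summits.ValiantsHypothesis.ValiantsHypothesis.Theorems.FifoMatchingNNDivisionHardSparseEdgePassenger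
import Summits.ValiantsHypothesis.ValiantsHypothesis.Theorems.FifoMatchingNNDivisionHardLowDimRung
import Summits.ValiantsHypothesis.ValiantsHypothesis.Theorems.FifoMatchingXcDivisionChamberCertificate
import Summits.ValiantsHypothesis.ValiantsHypothesis.Theorems.FifoMatchingXcDivisionDiagonalPassenger

/-!
# FifoMatching · NNDivisionHard — the GADGET READ and GADGET RIGIDITY (PROP E for arbitrary passengers; `PatternFreePassengerLaw`)

Theorems-grade port (bytes staged by val-idea-43 g5 for a port hand; AUTHOR of the block: the pen lineage val-idea-42, crux workfile
`GadgetRigidity.lean`) of §2 `…Cruxes.NNDivisionHard.VirtualPassenger.Gadget` of the registered LINE `Cruxes/NNDivisionHard/Lines/virtual_passenger.lean`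
rev 18 @21a5fb60d209 (pen val-idea-42 g2), lines 334–635 — statements and proofs VERBATIM; edits: namespace
`…Theorems.FifoMatching.VirtualPassengerGadget`, `T` a local abbrev δ-equal to `XcDivision.T`, PROP D₀ cited from ✓-to-be `…Theorems.FifoMatchingXcDivisionDiagonalPassenger` (`XcDivision.corPolytope_succ_add_diag_three_pow_le`, one qualified name shortened) instead of the `xc_division` workfile, helper docstrings.  Purpose: the pen's BYTES NOTE
2026-08-28T23:26:44Z (line at 199.5/200 KB; this block ≈ 17 KB); after landing the line replaces §2 by `import` + `open …VirtualPassengerGadget`.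
-/

set_option linter.unusedVariables false
set_option linter.unusedSectionVars false
set_option linter.dupNamespace false

namespace Summit.ValiantsHypothesis.ValiantsHypothesis.Theorems.FifoMatching.VirtualPassengerGadget


open scoped NNReal Pointwise
open MvPolynomial
open Literature.Computability.AlgebraicComplexity (complexity nestFreeMatchingPoly)
open Literature.Computability.AlgebraicComplexity.MonotoneCircuitEF (hasEFOfSize_newtonPolytope_complexity)
open Literature.Algebra.Polynomial.NewtonPolytope (newtonPolytope newtonPolytope_mul)
open Literature.Barriers.PneNP (HasEFOfSize)
open Literature.Combinatorics.Optimization (corPolytopeGraph corVec)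
open Summit.ValiantsHypothesis.ValiantsHypothesis.Theorems.FifoMatching.XcDivision

/-- the route's quasi-polynomial threshold `T c n = 2^((log₂ n + c)^c)`. -/
abbrev T (c n : ℕ) : ℕ := 2 ^ ((Nat.log 2 n + c) ^ c)


/-! ## Card 2 — gadget rigidity: PROP E for arbitrary passengers, generic perturbation -/

section Gadget

variable {m n : ℕ}

/-- `W_ι` — the span of the vertex set of the AND-gadget face of `COR(K_n)` (consistent `b`, unused coordinates free): … ⟨abr.⟩ -/
def gadgetSpan (ι : Fin m ⊕ (Fin m × Fin m) ↪ Fin n) : Submodule ℝ (Fin n × Fin n → ℝ) :=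
  Submodule.span ℝ (Set.range fun b : {b : Fin n → Bool //
      ∀ g : Fin m × Fin m, b (wSlot ι g) = (b (uSlot ι g.1) && b (uSlot ι g.2))} =>
    corVec (⊤ : SimpleGraph (Fin n)) b.1)

/-- ★ **GADGET RIGIDITY (first lemma of card `gadget-rigidity-law`, PROVED)**: every `d ∈ W_ι` has EQUAL entries at … ⟨abr.⟩ -/
theorem gadget_rigidity (ι : Fin m ⊕ (Fin m × Fin m) ↪ Fin n) {d : Fin n × Fin n → ℝ}
    (hd : d ∈ gadgetSpan ι) (g : Fin m × Fin m) (hg : g.1 ≠ g.2) :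
    d (uSlot ι g.1, wSlot ι g) = d (wSlot ι g, wSlot ι g) ∧
    d (uSlot ι g.2, wSlot ι g) = d (wSlot ι g, wSlot ι g) ∧
    d (uSlot ι g.1, uSlot ι g.2) = d (wSlot ι g, wSlot ι g) := by
  induction hd using Submodule.span_induction with
  | mem x hx =>
    obtain ⟨⟨b, hb⟩, rfl⟩ := hx
    have hu : uSlot ι g.1 ≠ uSlot ι g.2 := fun h => hg (Sum.inl_injective (ι.injective h))
    have huw1 : uSlot ι g.1 ≠ wSlot ι g := fun h => Sum.inl_ne_inr (ι.injective h)
    have huw2 : uSlot ι g.2 ≠ wSlot ι g := fun h => Sum.inl_ne_inr (ι.injective h)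
    simp only [corVec_top_apply, hb g]
    refine ⟨?_, ?_, ?_⟩ <;>
      cases b (uSlot ι g.1) <;> cases b (uSlot ι g.2) <;> simp
  | zero => simp
  | add x y _ _ hx hy =>
    simp only [Pi.add_apply]
    exact ⟨by rw [hx.1, hy.1], by rw [hx.2.1, hy.2.1], by rw [hx.2.2, hy.2.2]⟩
  | smul a x _ hx =>
    simp only [Pi.smul_apply, smul_eq_mul]
    exact ⟨by rw [hx.1], by rw [hx.2.1], by rw [hx.2.2]⟩

/-- **ONE-LEVEL GENERIC READ (PROP E for an ARBITRARY V-passenger; M-sized target)**: an EF of `COR(K_n) + conv{q_j}` o … ⟨abr.⟩ -/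
def GenericGadgetRead : Prop :=
  ∀ {m n : ℕ} (ι : Fin m ⊕ (Fin m × Fin m) ↪ Fin n) {J : Type} [Fintype J] [Nonempty J]
    (q : J → (Fin n × Fin n → ℝ)) (r : ℕ),
    HasEFOfSize (corPolytopeGraph (⊤ : SimpleGraph (Fin n)) + convexHull ℝ (Set.range q)) r →
    ∃ J' : Finset J, J'.Nonempty ∧ (∀ j ∈ J', ∀ j' ∈ J', q j - q j' ∈ gadgetSpan ι) ∧
      HasEFOfSize (corPolytopeGraph (⊤ : SimpleGraph (Fin m)) +
        convexHull ℝ ((fun j => diagRead ι (q j)) '' (J' : Set J))) r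


/-! ### The generic read, PROVED by iterated faces (no genericity lemma needed): each face in a direction vanishing on … ⟨abr.⟩ -/

open Classical in
/-- the GADGET READ, iterated (induction on `|Jk|`): from an EF of size `r` of `(COR(K_n) ∩ {andDir ι = 0}) + conv (q '' Jk)`, a nonempty
`J' ⊆ Jk` whose pairwise differences lie in `gadgetSpan ι`, with an EF of the same size for `J'`. -/
theorem read_iterate (ι : Fin m ⊕ (Fin m × Fin m) ↪ Fin n) {J : Type} (q : J → (Fin n × Fin n → ℝ)) (r : ℕ) :
    ∀ (N : ℕ) (Jk : Finset J), Jk.card ≤ N → Jk.Nonempty →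
      HasEFOfSize (corPolytopeGraph (⊤ : SimpleGraph (Fin n)) ∩ {x | andDir ι ⬝ᵥ x = 0} +
        convexHull ℝ (q '' (Jk : Set J))) r →
      ∃ J' : Finset J, J' ⊆ Jk ∧ J'.Nonempty ∧ (∀ j ∈ J', ∀ j' ∈ J', q j - q j' ∈ gadgetSpan ι) ∧
        HasEFOfSize (corPolytopeGraph (⊤ : SimpleGraph (Fin n)) ∩ {x | andDir ι ⬝ᵥ x = 0} +
          convexHull ℝ (q '' (J' : Set J))) r := by
  intro N
  induction N with
  | zero =>
    intro Jk hcard hne _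
    have := Finset.card_pos.2 hne
    omega
  | succ N ih =>
    intro Jk hcard hne hEF
    by_cases hall : ∀ j ∈ Jk, ∀ j' ∈ Jk, q j - q j' ∈ gadgetSpan ι
    · exact ⟨Jk, Finset.Subset.refl _, hne, hall, hEF⟩
    push Not at hall
    obtain ⟨j, hj, j', hj', hd⟩ := hall
    -- a functional vanishing on `W_ι` and not on `q j - q j'`
    obtain ⟨f, hf, hfW⟩ := Submodule.exists_dual_map_eq_bot_of_notMem hd inferInstance
    obtain ⟨φ, hφdef⟩ : ∃ φ : Fin n × Fin n → ℝ, φ = fun i => f (Pi.single i 1) := ⟨_, rfl⟩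
    have hφ : ∀ v, φ ⬝ᵥ v = f v := by
      intro v
      conv_rhs => rw [pi_eq_sum_univ' v, map_sum]
      simp only [dotProduct, map_smul, smul_eq_mul, hφdef]
      exact Finset.sum_congr rfl fun i _ => mul_comm _ _
    have hW : ∀ w ∈ gadgetSpan ι, φ ⬝ᵥ w = 0 := by
      intro w hw
      rw [hφ]
      have hmem : f w ∈ (gadgetSpan ι).map f := Submodule.mem_map_of_mem hw
      rw [hfW, Submodule.mem_bot] at hmem
      exact hmem
    -- the consistent face lies in `W_ι`, so `φ` vanishes on it
    have hCF0 : ∀ x ∈ corPolytopeGraph (⊤ : SimpleGraph (Fin n)) ∩ {x | andDir ι ⬝ᵥ x = 0}, φ ⬝ᵥ x = 0 := by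
      intro x hx
      have hx' : x ∈ convexHull ℝ (Set.range fun b : {b : Fin n → Bool //
          andDir ι ⬝ᵥ corVec (⊤ : SimpleGraph (Fin n)) b = 0} => corVec (⊤ : SimpleGraph (Fin n)) b.1) := by
        have hx2 := hx
        unfold corPolytopeGraph at hx2
        rwa [convexHull_range_inter_eq _ (andDir ι) 0 (andDir_dot_corVec_le ι)] at hx2
      have hgen : ∀ y ∈ Set.range (fun b : {b : Fin n → Bool //
          andDir ι ⬝ᵥ corVec (⊤ : SimpleGraph (Fin n)) b = 0} => corVec (⊤ : SimpleGraph (Fin n)) b.1),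
          φ ⬝ᵥ y = 0 := by
        rintro _ ⟨b, rfl⟩
        apply hW
        exact Submodule.subset_span ⟨⟨b.1, consistent_of_andDir_dot_eq_zero ι b.2⟩, rfl⟩
      have h1 := dot_le_of_mem_convexHull _ φ 0 (fun y hy => (hgen y hy).le) x hx'
      have h2 := dot_le_of_mem_convexHull _ (-φ) 0
        (fun y hy => by rw [neg_dotProduct, hgen y hy, neg_zero]) x hx'
      rw [neg_dotProduct] at h2
      linarith
    -- maximum of `φ` over the current passenger generators
    obtain ⟨j₀, hj₀, hmax⟩ := Finset.exists_max_image Jk (fun i => φ ⬝ᵥ q i) hne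
    have hQ : ∀ y ∈ convexHull ℝ (q '' (Jk : Set J)), φ ⬝ᵥ y ≤ φ ⬝ᵥ q j₀ :=
      dot_le_of_mem_convexHull _ φ _ (by rintro _ ⟨i, hi, rfl⟩; exact hmax i hi)
    have hface := hEF.face_add_face₁ φ 0 (φ ⬝ᵥ q j₀) (fun x hx => (hCF0 x hx).le) hQ
    -- identify the two faces
    have hCFeq : (corPolytopeGraph (⊤ : SimpleGraph (Fin n)) ∩ {x | andDir ι ⬝ᵥ x = 0}) ∩ {x | φ ⬝ᵥ x = 0} =
        corPolytopeGraph (⊤ : SimpleGraph (Fin n)) ∩ {x | andDir ι ⬝ᵥ x = 0} :=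
      Set.inter_eq_left.2 fun x hx => hCF0 x hx
    have hQeq : convexHull ℝ (q '' (Jk : Set J)) ∩ {y | φ ⬝ᵥ y = φ ⬝ᵥ q j₀} =
        convexHull ℝ (q '' ((Jk.filter fun i => φ ⬝ᵥ q i = φ ⬝ᵥ q j₀ : Finset J) : Set J)) := by
      rw [Set.image_eq_range q (Jk : Set J),
        convexHull_range_inter_eq (fun x : (Jk : Set J) => q x) φ (φ ⬝ᵥ q j₀)
          (fun i => hmax i.1 (Finset.mem_coe.1 i.2))]
      congr 1
      ext y
      constructor
      · rintro ⟨⟨⟨i, hi⟩, hφi⟩, rfl⟩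
        exact ⟨i, Finset.mem_coe.2 (Finset.mem_filter.2 ⟨hi, hφi⟩), rfl⟩
      · rintro ⟨i, hi, rfl⟩
        exact ⟨⟨⟨i, (Finset.mem_filter.1 (Finset.mem_coe.1 hi)).1⟩,
          (Finset.mem_filter.1 (Finset.mem_coe.1 hi)).2⟩, rfl⟩
    rw [hCFeq, hQeq] at hface
    -- the new index set is smaller and nonempty
    have hsub : (Jk.filter fun i => φ ⬝ᵥ q i = φ ⬝ᵥ q j₀) ⊆ Jk := Finset.filter_subset _ _
    have hne' : (Jk.filter fun i => φ ⬝ᵥ q i = φ ⬝ᵥ q j₀).Nonempty :=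
      ⟨j₀, Finset.mem_filter.2 ⟨hj₀, rfl⟩⟩
    have hlt : (Jk.filter fun i => φ ⬝ᵥ q i = φ ⬝ᵥ q j₀).card < Jk.card := by
      apply Finset.card_lt_card
      refine Finset.ssubset_iff_subset_ne.2 ⟨hsub, fun heq => ?_⟩
      have e1 := (Finset.mem_filter.1 (heq ▸ hj)).2
      have e2 := (Finset.mem_filter.1 (heq ▸ hj')).2
      apply hf
      rw [← hφ, dotProduct_sub, e1, e2, sub_self]
    obtain ⟨J', hJ', hneJ', hallJ', hEFJ'⟩ := ih _ (by omega) hne' hface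
    exact ⟨J', hJ'.trans hsub, hneJ', hallJ', hEFJ'⟩

open Classical in
/-- ★ **THE GENERIC GADGET READ IS A THEOREM** (`GenericGadgetRead` holds). -/
theorem genericGadgetRead_holds : GenericGadgetRead := by
  intro m n ι J _ _ q r hEF
  -- step 0: the `andDir` face
  obtain ⟨j₀, -, hmax⟩ :=
    Finset.exists_max_image Finset.univ (fun j => andDir ι ⬝ᵥ q j) Finset.univ_nonempty
  have hQ : ∀ y ∈ convexHull ℝ (Set.range q), andDir ι ⬝ᵥ y ≤ andDir ι ⬝ᵥ q j₀ :=
    dot_le_of_mem_convexHull _ _ _ (by rintro _ ⟨j, rfl⟩; exact hmax j (Finset.mem_univ _))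
  have h0 := hEF.face_add_face₁ (andDir ι) 0 (andDir ι ⬝ᵥ q j₀) (andDir_valid ι) hQ
  have hQeq : convexHull ℝ (Set.range q) ∩ {y | andDir ι ⬝ᵥ y = andDir ι ⬝ᵥ q j₀} =
      convexHull ℝ (q '' ((Finset.univ.filter fun j => andDir ι ⬝ᵥ q j = andDir ι ⬝ᵥ q j₀ : Finset J) :
        Set J)) := by
    rw [convexHull_range_inter_eq q (andDir ι) _ (fun j => hmax j (Finset.mem_univ _))]
    congr 1
    ext y
    constructor
    · rintro ⟨⟨j, hj⟩, rfl⟩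
      exact ⟨j, Finset.mem_coe.2 (Finset.mem_filter.2 ⟨Finset.mem_univ _, hj⟩), rfl⟩
    · rintro ⟨j, hj, rfl⟩
      exact ⟨⟨j, (Finset.mem_filter.1 (Finset.mem_coe.1 hj)).2⟩, rfl⟩
  rw [hQeq] at h0
  have hne₁ : (Finset.univ.filter fun j => andDir ι ⬝ᵥ q j = andDir ι ⬝ᵥ q j₀ : Finset J).Nonempty :=
    ⟨j₀, Finset.mem_filter.2 ⟨Finset.mem_univ _, rfl⟩⟩
  obtain ⟨J', -, hne', hall, hEF'⟩ := read_iterate ι q r _ _ le_rfl hne₁ h0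
  refine ⟨J', hne', hall, ?_⟩
  have h2 := hEF'.image_linearMap (diagRead ι)
  rw [Set.image_add, diagRead_image_cor_face, LinearMap.image_convexHull, Set.image_image] at h2
  exact h2

end Gadget

/-- the nonzero EQUAL-ENTRY GADGET PATTERN of a direction `d` on an (ordered) triple of distinct indices. -/
def HasGadgetPattern {h : ℕ} (d : Fin h × Fin h → ℝ) : Prop :=
  ∃ z₁ z₂ z₃ : Fin h, z₁ ≠ z₂ ∧ z₁ ≠ z₃ ∧ z₂ ≠ z₃ ∧ d (z₃, z₃) ≠ 0 ∧
    d (z₁, z₃) = d (z₃, z₃) ∧ d (z₂, z₃) = d (z₃, z₃) ∧ d (z₁, z₂) = d (z₃, z₃)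

/-- **LAW_generic (restricted-Q law, typed target)**: a passenger none of whose vertex differences carries the gadget p … ⟨abr.⟩ -/
def PatternFreePassengerLaw : Prop :=
  ∀ (h K : ℕ) (q : Fin (K + 1) → (Fin h × Fin h → ℝ)) (r : ℕ),
    (∀ j j', ¬ HasGadgetPattern (q j - q j')) →
    HasEFOfSize (corPolytopeGraph (⊤ : SimpleGraph (Fin h)) + convexHull ℝ (Set.range q)) r →
      (3 / 2 : ℝ) ^ ((Nat.sqrt h : ℝ) - 3) ≤ r + 1

/-- for `d ∈ W_ι` WITHOUT the gadget pattern, the diagonal read `diagRead ι d` vanishes off the diagonal ( … ⟨abr.⟩ -/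
theorem diagRead_offDiag_eq_zero {m n : ℕ} (ι : Fin m ⊕ (Fin m × Fin m) ↪ Fin n) {d : Fin n × Fin n → ℝ}
    (hd : d ∈ gadgetSpan ι) (hpf : ¬ HasGadgetPattern d) {i j : Fin m} (hij : i ≠ j) :
    diagRead ι d (i, j) = 0 := by
  have hpos : slotPos ι (i, j) = (wSlot ι (i, j), wSlot ι (i, j)) := by simp [slotPos, hij]
  rw [diagRead_apply, hpos]
  by_contra hne
  obtain ⟨h1, h2, h3⟩ := gadget_rigidity ι hd (i, j) hij
  apply hpf
  refine ⟨uSlot ι i, uSlot ι j, wSlot ι (i, j), ?_, ?_, ?_, hne, h1, h2, h3⟩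
  · exact fun h => hij (Sum.inl_injective (ι.injective h))
  · exact fun h => Sum.inl_ne_inr (ι.injective h)
  · exact fun h => Sum.inl_ne_inr (ι.injective h)

open Literature.Combinatorics.Optimization.FixedSizePsdRank (corPolytope flat) in
/-- ★★ **LAW_generic IS A THEOREM (`PatternFreePassengerLaw` holds)**: pattern-free passengers are decided at rate … ⟨abr.⟩ -/
theorem patternFreePassengerLaw_holds : PatternFreePassengerLaw := by
  intro h K q r hpf hEF
  classical
  have hr1 : (1 : ℝ) ≤ r + 1 := by
    have : (0 : ℝ) ≤ r := Nat.cast_nonneg _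
    linarith
  by_cases hs : Nat.sqrt h < 3
  · calc (3 / 2 : ℝ) ^ ((Nat.sqrt h : ℝ) - 3) ≤ 1 := by
          apply Real.rpow_le_one_of_one_le_of_nonpos (by norm_num)
          have : (Nat.sqrt h : ℝ) < 3 := by exact_mod_cast hs
          linarith
      _ ≤ r + 1 := hr1
  push Not at hs
  -- the level `m + 1 = ⌊√h⌋ − 1`
  obtain ⟨m, hm⟩ : ∃ m, Nat.sqrt h = m + 2 := ⟨Nat.sqrt h - 2, by omega⟩
  have hmn : (m + 1) + (m + 1) * (m + 1) ≤ h := by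
    have h1 := Nat.sqrt_le h
    rw [hm] at h1
    nlinarith
  have hne : Nonempty (Fin (m + 1) ⊕ (Fin (m + 1) × Fin (m + 1)) ↪ Fin h) := by
    rw [Function.Embedding.nonempty_iff_card_le]
    simpa using hmn
  obtain ⟨ι⟩ := hne
  obtain ⟨J', hJ'ne, hall, hEF'⟩ := genericGadgetRead_holds ι q r hEF
  obtain ⟨j₁, hj₁⟩ := hJ'ne
  -- the read passenger is `y₀ +` diagonal
  have hQ'diag : ∀ y ∈ convexHull ℝ ((fun j => diagRead ι (q j)) '' (J' : Set (Fin (K + 1)))),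
      ∀ i i' : Fin (m + 1), i ≠ i' → y (i, i') = diagRead ι (q j₁) (i, i') := by
    intro y hy
    refine (convexHull_min ?_ ?_ : convexHull ℝ ((fun j => diagRead ι (q j)) '' (J' : Set (Fin (K + 1)))) ⊆
      {y | ∀ i i' : Fin (m + 1), i ≠ i' → y (i, i') = diagRead ι (q j₁) (i, i')}) hy
    · rintro _ ⟨j, hj, rfl⟩ i i' hii'
      have hd := diagRead_offDiag_eq_zero ι (hall j hj j₁ hj₁) (hpf j j₁) hii'
      rw [map_sub, Pi.sub_apply, sub_eq_zero] at hd
      exact hd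
    · intro y hy z hz a b _ _ hab i i' hii'
      simp only [Set.mem_setOf_eq] at hy hz
      simp only [Pi.add_apply, Pi.smul_apply, smul_eq_mul, hy i i' hii', hz i i' hii']
      rw [← add_mul, hab, one_mul]
  -- flatten to the `corPolytope` currency
  let e : (Fin (m + 1) × Fin (m + 1) → ℝ) ≃ₗ[ℝ] (Fin ((m + 1) * (m + 1)) → ℝ) :=
    LinearEquiv.funCongrLeft ℝ ℝ (finProdFinEquiv (m := m + 1) (n := m + 1)).symm
  have himg : e '' (corPolytopeGraph (⊤ : SimpleGraph (Fin (m + 1))) +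
      convexHull ℝ ((fun j => diagRead ι (q j)) '' (J' : Set (Fin (K + 1))))) =
      corPolytope (m + 1) + e '' convexHull ℝ ((fun j => diagRead ι (q j)) '' (J' : Set (Fin (K + 1)))) := by
    rw [Set.image_add, Literature.Barriers.PneNP.corPolytope_eq_image_corPolytopeGraph_top]
  have hEF'' : HasEFOfSize (corPolytope (m + 1) +
      e '' convexHull ℝ ((fun j => diagRead ι (q j)) '' (J' : Set (Fin (K + 1))))) r := by
    rw [← himg]
    exact (HasEFOfSize.image_linearEquiv_iff e).2 hEF'
  have hy₀Q : e (diagRead ι (q j₁)) ∈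
      e '' convexHull ℝ ((fun j => diagRead ι (q j)) '' (J' : Set (Fin (K + 1)))) :=
    ⟨_, subset_convexHull ℝ _ ⟨j₁, hj₁, rfl⟩, rfl⟩
  have hdiag : ∀ y ∈ e '' convexHull ℝ ((fun j => diagRead ι (q j)) '' (J' : Set (Fin (K + 1)))),
      ∃ σ : Fin (m + 1) → ℝ, y = e (diagRead ι (q j₁)) + flat (Matrix.diagonal σ) := by
    rintro _ ⟨y, hy, rfl⟩
    refine ⟨fun i => y (i, i) - diagRead ι (q j₁) (i, i), ?_⟩
    funext p
    simp only [e, Pi.add_apply, flat, LinearEquiv.funCongrLeft_apply, LinearMap.funLeft_apply]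
    generalize finProdFinEquiv.symm p = ab
    obtain ⟨a, b⟩ := ab
    by_cases hab : a = b
    · subst hab
      simp
    · rw [Matrix.diagonal_apply_ne _ hab, add_zero]
      exact hQ'diag y hy a b hab
  have hD0 := corPolytope_succ_add_diag_three_pow_le
    hEF'' hy₀Q hdiag
  -- conclude: `(3/2)^{√h − 3} ≤ (3/2)^m ≤ r + 1`
  have h32 : (3 / 2 : ℝ) ^ (m : ℝ) ≤ r + 1 := by
    rw [Real.rpow_natCast, div_pow, div_le_iff₀ (by positivity)]
    exact_mod_cast hD0
  calc (3 / 2 : ℝ) ^ ((Nat.sqrt h : ℝ) - 3) ≤ (3 / 2 : ℝ) ^ (m : ℝ) := by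
        apply Real.rpow_le_rpow_of_exponent_le (by norm_num)
        rw [hm]
        push_cast
        linarith
    _ ≤ r + 1 := h32

/-- index support of a direction: the indices its nonzero entries touch. -/
noncomputable def indexSupport {h : ℕ} (d : Fin h × Fin h → ℝ) : Finset (Fin h) :=
  Finset.univ.filter fun z => ∃ z', d (z, z') ≠ 0 ∨ d (z', z) ≠ 0

/-- **LAW_sparse (restricted-Q law, typed target, route rate)**: passengers all of whose vertex differences touch … ⟨abr.⟩ -/
def SparseEdgePassengerLaw : Prop :=
  ∀ c : ℕ, ∃ h₀ : ℕ, ∀ h ≥ h₀, ∀ (K : ℕ) (q : Fin (K + 1) → (Fin h × Fin h → ℝ)) (r : ℕ),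
    (∀ j j', (indexSupport (q j - q j')).card ≤ Nat.log 2 (Nat.log 2 h)) →
    HasEFOfSize (corPolytopeGraph (⊤ : SimpleGraph (Fin h)) + convexHull ℝ (Set.range q)) r → T c h < r

end Summit.ValiantsHypothesis.ValiantsHypothesis.Theorems.FifoMatching.VirtualPassengerGadget
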